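import Summits.KontsevichZagierPeriods.Zeta5Search.LaiSweepShard

/-!
# `κ₃` sweep certificate — shard file 042 of 127 (shards 294–300 of 889)

HONEST FRAMING. Systematic search; no irrationality claim unless certified. This file only checks,
by `decide +kernel`, shards 294–300 of the order-cell sweep of the `κ₃` point `(74, 2180, 444; δ74)`
(engine `LaiSweepEngine`, soundness `LaiSweepJump/Free/Eval/Shard/Kappa3`; a shard is `⟨regime, n,
p, q, p', q', Lo, Up⟩`: `n` cells from `p/q` to `p'/q'` with integer rate sums in `[Lo, Up]`, `K =
128`, `D = 2^40`). It draws NO conclusion: only the capstone `LaiKappa3SweepCert`, which needs all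
127 shard files, does. Kernel cost of this file ≈ 560 cells × 0.3 s.
-/

namespace Summit.KontsevichZagierPeriods.Zeta5Search.Sweep

set_option maxHeartbeats 100000000 in
/-- Shard 294: 80 cells of regime B from `605/2402` to `61/241`.
[cite: Lai2024BallRivoal, §4 Lemma 4.3] -/
theorem shard294 :
    Shard.check 128 (2^40)
      ⟨true, 80, 605, 2402, 61, 241, 25716578842308, 26958844133496⟩ = true := by
  decide +kernel

set_option maxHeartbeats 100000000 in
/-- Shard 295: 80 cells of regime B from `61/241` to `102/401`.
[cite: Lai2024BallRivoal, §4 Lemma 4.3] -/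
theorem shard295 :
    Shard.check 128 (2^40)
      ⟨true, 80, 61, 241, 102, 401, 26140177812528, 27417287954510⟩ = true := by
  decide +kernel

set_option maxHeartbeats 100000000 in
/-- Shard 296: 80 cells of regime B from `102/401` to `80/313`.
[cite: Lai2024BallRivoal, §4 Lemma 4.3] -/
theorem shard296 :
    Shard.check 128 (2^40)
      ⟨true, 80, 102, 401, 80, 313, 25499111151572, 26758993303768⟩ = true := by
  decide +kernel

set_option maxHeartbeats 100000000 in
/-- Shard 297: 80 cells of regime B from `80/313` to `103/401`.
[cite: Lai2024BallRivoal, §4 Lemma 4.3] -/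
theorem shard297 :
    Shard.check 128 (2^40)
      ⟨true, 80, 80, 313, 103, 401, 26238864637129, 27549833108219⟩ = true := by
  decide +kernel

set_option maxHeartbeats 100000000 in
/-- Shard 298: 80 cells of regime B from `103/401` to `111/430`.
[cite: Lai2024BallRivoal, §4 Lemma 4.3] -/
theorem shard298 :
    Shard.check 128 (2^40)
      ⟨true, 80, 103, 401, 111, 430, 26376270799318, 27709525158020⟩ = true := by
  decide +kernel

set_option maxHeartbeats 100000000 in
/-- Shard 299: 80 cells of regime B from `111/430` to `83/320`.
[cite: Lai2024BallRivoal, §4 Lemma 4.3] -/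
theorem shard299 :
    Shard.check 128 (2^40)
      ⟨true, 80, 111, 430, 83, 320, 25424006636116, 26723530263609⟩ = true := by
  decide +kernel

set_option maxHeartbeats 100000000 in
/-- Shard 300: 80 cells of regime B from `83/320` to `43/165`.
[cite: Lai2024BallRivoal, §4 Lemma 4.3] -/
theorem shard300 :
    Shard.check 128 (2^40)
      ⟨true, 80, 83, 320, 43, 165, 25136043740369, 26434148968814⟩ = true := by
  decide +kernel

/-- The checked shards of this file, in order. [folklore] -/
def shards042 : List (CheckedShard 128 (2^40)) :=
  [⟨_, shard294⟩, ⟨_, shard295⟩, ⟨_, shard296⟩, ⟨_, shard297⟩, ⟨_, shard298⟩,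
    ⟨_, shard299⟩, ⟨_, shard300⟩]

end Summit.KontsevichZagierPeriods.Zeta5Search.Sweep
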